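import Literature.AlgebraicGeometry.Frobenioids.Thm49Compat
import Literature.AlgebraicGeometry.Frobenioids.Thm49RightEqLeftAssembly
import Literature.AlgebraicGeometry.Frobenioids.Thm42DivEquivalentPreserved
import Literature.AlgebraicGeometry.Frobenioids.Thm49TwinPrimaryExistence
import Literature.AlgebraicGeometry.Frobenioids.EquivalenceUnitsTransport
import Literature.AlgebraicGeometry.Frobenioids.BiratLocalization
import Literature.AlgebraicGeometry.Frobenioids.Thm49SufficesRightEqLeftProofs
import Literature.AlgebraicGeometry.Frobenioids.Prop55SubRatStdSlot
import HarnessLib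

/-!
# [FrdI] Theorem 4.9 with its `Ψ^Prime`-compatibility clause, assembled at the `T42.Setting` level
# (perfect, isotropic type) modulo row T49-L02

Mochizuki, *The geometry of Frobenioids I: the general theory*, Kyushu J. Math. **62** (2008) 293–400,
§4, Theorem 4.9, kurims p. 88 l. 40 – p. 90 l. 4 [cite: MochizukiFrdI2008, Thm. 4.9 p.89].

PROOF-ONLY composition (seat abc-iut-w4-d105, gen 2; S5 sub-DAG `plan/L1/SUBDAG-FrdI-Thm42-Thm49.md`):
`FrdI.T49.exists_primesEquiv_rightEqLeftAt_of_cover` (`Thm49RightEqLeftAssembly.lean`, seat abc-iut-w4-d099: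
rows T49-L05/L06/L07/L08′ ⇒ `Ψ^Prime` + the right = left slots at universally Div-Frobenius-trivial objects)
+ `FrdI.T49.invDiv_map_mem_carrier_of_clauseB` + `FrdI.T49.exists_thm49_compat_of_sufficesRightEqLeft`
(`Thm49Compat.lean`) ⇒ in a `T42.Setting`, modulo row T49-L02 `SufficesRightEqLeft` (hypothesis; closer
staged by seat abc-iut-w4-d035): `Ψ^Prime` (clauses (a), (b)) and an isomorphism of functors `Ψ^Φ : Φ₁ ⥲ Φ₂`
over `Ψ` (closing shape of the typed `Thm49`) computing divisors of pre-steps and satisfying the typed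
`Thm49_compat`. No new definitions; nothing here bears on [IUTchIII] Cor. 3.12.

## Part 2 (seat abc-iut-w4-d099, gen 2): print's cover ("strictly rational") and the Thm. 4.2 inputs discharged — Thm. 4.9 at the perfections modulo the single row T49-L02

Proof of Theorem 4.9, p. 89 l. 38 – p. 90 l. 54 (render `paper:url-bbf705efa10f`, read on the page)
[cite: MochizukiFrdI2008, Thm. 4.9 p.89]:

> "Let `A` be a universally Div-Frobenius-trivial object of `C_i` … we may assume without loss of
> generality that `A` is strictly rational. Then it suffices to show, for each `𝔭 ∈ Prime(Φ₁(A))`, the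
> existence of twin-primary steps with zero divisor in `𝔭` that are mapped by `Ψ` to twin-primary steps
> of `C₂`. But since `A` is strictly rational, it follows [cf. Definition 4.5, (ii)] that there exist …
> [such squares] … since `Ψ` preserves pre-steps [cf. Theorem 3.4, (ii)], primary steps [cf. Theorem 4.2,
> (i)], Div-equivalent pairs of base-isomorphisms [cf. Theorem 4.2, (ii); the fact that `Φ_i` is
> non-dilating], and cartesian diagrams as in Proposition 4.1, (iii) …, we thus conclude that for each
> `𝔭 ∈ Prime(Φ₁(A))`, there exist twin-primary steps with zero divisor in `𝔭` that are mapped by `Ψ` to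
> twin-primary steps of `C₂`. This completes the proof of Theorem 4.9."

Part 2 (proof-only as well; this file was staged by seat abc-iut-w4-d105 gen 2 as "READY-TO-FILE by any of
g0/d099/d109" and is filed by seat abc-iut-w4-d099 gen 2 with Part 2 appended) INSTANTIATES the
generic-cover assembly `FrdI.T49.exists_thm49_compat_of_cover` above at print's cover and discharges its
Thm. 4.2 inputs:
* `P := ` "strictly rational" (Def. 4.5 (ii): `PreFrobenioidData.IsStrictlyRational` at THE birationalization
  `PreFrobenioid.biratData` of Prop. 4.4, with a support predicate obeying the support axiom of
  Def. 2.4 (i)(d)); its twin-primary witnesses = rows T49-L07/L08′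
  (`FrdI.T49.exists_twinPrimary_pair_of_isStrictlyRational`, seats abc-iut-w5-d021 / abc-iut-w4-d105);
  the cover = "every universally Div-Frobenius-trivial object is rational" (Def. 4.5 (ii):
  `PreFrobenioidData.IsRational` — a pull-back morphism from a strictly rational object; print's hypothesis
  "rationally standard type", Def. 4.5 (iii));
* "`Ψ`, `Ψ⁻¹` preserve primary pre-steps" (Thm. 4.2 (i)) := rows T42-L04–L07
  (`Setting.isPrimaryPreStep_map` / `Setting.isPrimaryPreStep_inverse_map`);
* "`Ψ` preserves the Div-identity endomorphisms" (Thm. 4.2 (i)) := row T42-L11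
  (`Setting.isDivIdentity_map`, `Thm42Assembly.lean`, seats abc-iut-w4-d068 / abc-iut-w5-d162), `Φ₂`
  non-dilating;
* "`Ψ` preserves Div-equivalent pairs of base-isomorphisms [Thm. 4.2 (ii); `Φ_i` non-dilating]" :=
  `Setting.divEquivalent_map` (`Thm42DivEquivalentPreserved.lean`).
Upshot (`exists_thm49_compat_of_isRational_of_nonDilating`): in the `T42.Setting` (PERFECT and isotropic
type — "after passing to the perfections", p. 89 l. 38 — `Φ_i` perf-factorial, which print folds into
"rational", Def. 4.5 (ii) p. 86 l. 13) with `Φ₂` non-dilating, the conclusion of Thm. 4.9 WITH its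
compatibility clause — THE `Ψ^Prime` of Thm. 4.2 (ii) and an isomorphism of functors `Ψ^Φ : Φ₁ ⥲ Φ₂` lying
over `Ψ` (the closing shape `PreFrobenioidData.DivisorMonoidIsoOver` of the typed `Thm49`), computing
`Div(Ψ φ) = Ψ^Φ_A(Div φ)` on pre-steps and satisfying the typed `Thm49_compat` — holds MODULO THE SINGLE NAMED
ROW T49-L02 `FrdI.T49.SufficesRightEqLeft` — and, that row being PROVED (`FrdI.T49.sufficesRightEqLeft_holds`,
`Thm49SufficesRightEqLeftProofs.lean`, seat abc-iut-w4-d035), UNCONDITIONALLY over print's hypotheses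
(`exists_thm49_compat_perfect`). The descent
from the perfections to `C` (Thm. 3.4 (iii) / Prop. 5.5 (iii); `DivisorMonoidIsoOver.nonempty_of_embedding`,
seat abc-iut-w4-d109) is the final node T49-L00 and is not claimed here. Nothing here bears on [IUTchIII].
-/

namespace Literature.AlgebraicGeometry.Frobenioids

open CategoryTheory Opposite

namespace FrdI.T49

universe w v v' u u'

variable {D₁ : Type u} [Category.{v} D₁] {Φ₁ : D₁ᵒᵖ ⥤ CommMonCat.{w}} {C₁ : Type u'} [Category.{v'} C₁]
  {D₂ : Type u} [Category.{v} D₂] {Φ₂ : D₂ᵒᵖ ⥤ CommMonCat.{w}} {C₂ : Type u'} [Category.{v'} C₂]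

/-- **Thm. 4.9 with its compatibility clause, assembled at the level of the `T42.Setting`** (perfect and
isotropic type, "after passing to perfections", p. 89 l. 38) modulo row T49-L02 (`SufficesRightEqLeft`,
hypothesis): from Thm. 4.2 (i) ("`Ψ`, `Ψ⁻¹` preserve primary steps"; Div-identity endomorphisms of
Div-Frobenius-trivial objects, row T42-L11), a class `P` of objects ("strictly rational") each carrying, at
every prime, twin-primary steps mapped by `Ψ` to twin-primary steps (rows T49-L07/L08′) and covering every
universally Div-Frobenius-trivial object by a pull-back morphism ("`A` rational", row T49-L05), one obtains
THE `Ψ^Prime` of Thm. 4.2 (ii) (clauses (a), (b)) together with an isomorphism of functors `Ψ^Φ : Φ₁ ⥲ Φ₂`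
over `Ψ` computing `Div(Ψ φ) = Ψ^Φ_A(Div φ)` on pre-steps and COMPATIBLE with `Ψ^Prime` (the typed
`Thm49_compat`). Composition of `FrdI.T49.exists_primesEquiv_rightEqLeftAt_of_cover` (seat abc-iut-w4-d099),
`invDiv_map_mem_carrier_of_clauseB` and `exists_thm49_compat_of_sufficesRightEqLeft`.
[cite: MochizukiFrdI2008, Thm. 4.9 p.89] -/
theorem exists_thm49_compat_of_cover (h : SufficesRightEqLeft.{w, v, v', u, u'})
    (F₁ : C₁ ⥤ ElemFrobenioid Φ₁) (F₂ : C₂ ⥤ ElemFrobenioid Φ₂) (Ψ : C₁ ≌ C₂) (S : T42.Setting F₁ F₂ Ψ)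
    (hprim : ∀ ⦃X Y : C₁⦄ (φ : X ⟶ Y), PreFrobenioid.IsPrimaryPreStep F₁ φ →
      PreFrobenioid.IsPrimaryPreStep F₂ (Ψ.functor.map φ))
    (hprim' : ∀ ⦃X Y : C₂⦄ (φ : X ⟶ Y), PreFrobenioid.IsPrimaryPreStep F₂ φ →
      PreFrobenioid.IsPrimaryPreStep F₁ (Ψ.inverse.map φ))
    (hdivid : ∀ ⦃A : C₁⦄, PreFrobenioid.IsDivFrobeniusTrivial F₁ A → ∀ α : A ⟶ A,
      PreFrobenioid.IsDivIdentity F₁ α → PreFrobenioid.IsDivIdentity F₂ (Ψ.functor.map α))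
    (P : C₁ → Prop)
    (htwin : ∀ ⦃A' : C₁⦄, P A' → ∀ 𝔮 : Primes (Φ₁.obj (op (PreFrobenioid.baseObj F₁ A'))),
      ∃ (B C' : C₁) (β : A' ⟶ B) (γ : C' ⟶ A'), IsTwinPrimary F₁ β γ ∧
        PreFrobenioid.Div F₁ β ∈ 𝔮.carrier ∧ IsTwinPrimary F₂ (Ψ.functor.map β) (Ψ.functor.map γ))
    (hcover : ∀ ⦃A : C₁⦄, PreFrobenioid.IsUniversallyDivFrobeniusTrivial F₁ A →
      ∃ (A' : C₁) (ψ : A' ⟶ A), PreFrobenioid.IsPullbackMorphism F₁ ψ ∧ P A') :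
    ∃ (E : PreFrobenioidData.DivisorMonoidIsoOver (PreFrobenioidData.ofFunctor Φ₁ F₁)
        (PreFrobenioidData.ofFunctor Φ₂ F₂) Ψ)
      (e : ∀ A : C₁, Primes (Φ₁.obj (op (PreFrobenioid.baseObj F₁ A))) ≃
        Primes (Φ₂.obj (op (PreFrobenioid.baseObj F₂ (Ψ.functor.obj A))))),
      (∀ (A : C₁) (𝔭 : Primes (Φ₁.obj (op (PreFrobenioid.baseObj F₁ A)))),
        (∀ ⦃B : C₁⦄ (φ : A ⟶ B), PreFrobenioid.IsCoAngularPreStep F₁ φ →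
            (PreFrobenioid.Div F₁ φ ∈ 𝔭.submonoid ↔
              PreFrobenioid.Div F₂ (Ψ.functor.map φ) ∈ (e A 𝔭).submonoid)) ∧
        ∀ ⦃B : C₁⦄ (ψ : B ⟶ A), PreFrobenioid.IsCoAngularPreStep F₁ ψ →
          ((∃ y ∈ 𝔭.submonoid, pull Φ₁ (PreFrobenioid.Base F₁ ψ) y = PreFrobenioid.Div F₁ ψ) ↔
            ∃ y ∈ (e A 𝔭).submonoid, pull Φ₂ (PreFrobenioid.Base F₂ (Ψ.functor.map ψ)) y =
              PreFrobenioid.Div F₂ (Ψ.functor.map ψ))) ∧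
      (∀ ⦃A B : C₁⦄ (φ : A ⟶ B), PreFrobenioid.IsPreStep F₁ φ →
          E.iso A (PreFrobenioid.Div F₁ φ) = PreFrobenioid.Div F₂ (Ψ.functor.map φ)) ∧
      Literature.AlgebraicGeometry.Frobenioids.PreFrobenioidData.Thm49_compat
        (PreFrobenioidData.ofFunctor Φ₁ F₁) (PreFrobenioidData.ofFunctor Φ₂ F₂) Ψ E e := by
  obtain ⟨e, he, hRL⟩ := exists_primesEquiv_rightEqLeftAt_of_cover S hprim hprim' hdivid P htwin hcover
  obtain ⟨E, hE, hc⟩ := exists_thm49_compat_of_sufficesRightEqLeft h F₁ F₂ Ψ S hprim hprim' e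
    (fun A 𝔭 => (he A 𝔭).1)
    (fun A _ ε hε 𝔭 h𝔭 h₂ => invDiv_map_mem_carrier_of_clauseB F₁ F₂ Ψ S e (fun A 𝔭 => (he A 𝔭).2)
      A ε hε 𝔭 h𝔭 h₂) hRL
  exact ⟨E, e, he, hE, hc⟩

/-! ## Part 2: print's cover ("strictly rational", Def. 4.5 (ii)) and the Thm. 4.2 inputs discharged -/

variable {F₁ : C₁ ⥤ ElemFrobenioid Φ₁} {F₂ : C₂ ⥤ ElemFrobenioid Φ₂} {Ψ : C₁ ≌ C₂}

set_option backward.isDefEq.respectTransparency false in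
/-- **[FrdI] Thm. 4.9 (with compatibility) at the perfections, rational cover, modulo row T49-L02**
(p. 89 l. 38 – p. 90 l. 54): in the `T42.Setting`, with `C₁` admitting the birationalization squares of
Prop. 4.4, a support predicate `Supp` obeying the support axiom of Def. 2.4 (i)(d), every universally
Div-Frobenius-trivial object of `C₁` rational (Def. 4.5 (ii)), and the two Thm. 4.2 inputs "`Ψ` preserves
the Div-identity endomorphisms of Div-Frobenius-trivial objects" and "`Ψ` preserves Div-equivalent pairs of
base-isomorphisms" as named hypotheses, row T49-L02 `SufficesRightEqLeft` yields THE `Ψ^Prime` (clauses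
(a), (b) of Thm. 4.2 (ii)) and an isomorphism of functors `Ψ^Φ : Φ₁ ⥲ Φ₂` over `Ψ` computing `Div(Ψ φ)` on
pre-steps and compatible with `Ψ^Prime` (`Thm49_compat`). [cite: MochizukiFrdI2008, Thm. 4.9 p.89] -/
theorem exists_thm49_compat_of_isRational (hL02 : SufficesRightEqLeft.{w, v, v', u, u'})
    (S : T42.Setting F₁ F₂ Ψ)
    (hdivid : ∀ ⦃A : C₁⦄, PreFrobenioid.IsDivFrobeniusTrivial F₁ A → ∀ α : A ⟶ A,
      PreFrobenioid.IsDivIdentity F₁ α → PreFrobenioid.IsDivIdentity F₂ (Ψ.functor.map α))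
    (hdiveq : ∀ ⦃X Y : C₁⦄ (φ ψ : X ⟶ Y), PreFrobenioid.IsBaseIso F₁ φ → PreFrobenioid.IsBaseIso F₁ ψ →
      PreFrobenioid.DivEquivalent F₁ φ ψ →
        PreFrobenioid.DivEquivalent F₂ (Ψ.functor.map φ) (Ψ.functor.map ψ))
    (hsq : PreFrobenioid.HasBiratSquares F₁)
    (Supp : ∀ {X : D₁}, (PreFrobenioidData.ofFunctor Φ₁ F₁).Mon X →
      Primes ((PreFrobenioidData.ofFunctor Φ₁ F₁).Mon X) → Prop)
    (hSupp : ∀ (X : D₁) (a : Φ₁.obj (op X)) (𝔭 : Primes (Φ₁.obj (op X))),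
      Supp a 𝔭 ↔ ∃ (a₀ : Φ₁.obj (op X)) (h₀ : IsPrimary a₀),
        Quotient.mk (primarySetoid _) ⟨a₀, h₀⟩ = 𝔭 ∧ Precsim a₀ a)
    (hrat : ∀ ⦃A : C₁⦄, PreFrobenioid.IsUniversallyDivFrobeniusTrivial F₁ A →
      PreFrobenioidData.IsRational (PreFrobenioid.biratData S.isFrobenioid₁ hsq) Supp A) :
    ∃ (E : PreFrobenioidData.DivisorMonoidIsoOver (PreFrobenioidData.ofFunctor Φ₁ F₁)
        (PreFrobenioidData.ofFunctor Φ₂ F₂) Ψ)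
      (e : ∀ A : C₁, Primes (Φ₁.obj (op (PreFrobenioid.baseObj F₁ A))) ≃
        Primes (Φ₂.obj (op (PreFrobenioid.baseObj F₂ (Ψ.functor.obj A))))),
      (∀ (A : C₁) (𝔭 : Primes (Φ₁.obj (op (PreFrobenioid.baseObj F₁ A)))),
        (∀ ⦃B : C₁⦄ (φ : A ⟶ B), PreFrobenioid.IsCoAngularPreStep F₁ φ →
            (PreFrobenioid.Div F₁ φ ∈ 𝔭.submonoid ↔
              PreFrobenioid.Div F₂ (Ψ.functor.map φ) ∈ (e A 𝔭).submonoid)) ∧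
        ∀ ⦃B : C₁⦄ (ψ : B ⟶ A), PreFrobenioid.IsCoAngularPreStep F₁ ψ →
          ((∃ y ∈ 𝔭.submonoid, pull Φ₁ (PreFrobenioid.Base F₁ ψ) y = PreFrobenioid.Div F₁ ψ) ↔
            ∃ y ∈ (e A 𝔭).submonoid, pull Φ₂ (PreFrobenioid.Base F₂ (Ψ.functor.map ψ)) y =
              PreFrobenioid.Div F₂ (Ψ.functor.map ψ))) ∧
      (∀ ⦃A B : C₁⦄ (φ : A ⟶ B), PreFrobenioid.IsPreStep F₁ φ →
          E.iso A (PreFrobenioid.Div F₁ φ) = PreFrobenioid.Div F₂ (Ψ.functor.map φ)) ∧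
      Literature.AlgebraicGeometry.Frobenioids.PreFrobenioidData.Thm49_compat
        (PreFrobenioidData.ofFunctor Φ₁ F₁) (PreFrobenioidData.ofFunctor Φ₂ F₂) Ψ E e := by
  refine exists_thm49_compat_of_cover hL02 F₁ F₂ Ψ S (fun _ _ _ hφ => S.isPrimaryPreStep_map hφ)
    (fun _ _ _ hφ => S.isPrimaryPreStep_inverse_map hφ) hdivid
    (PreFrobenioidData.IsStrictlyRational (PreFrobenioid.biratData S.isFrobenioid₁ hsq) Supp)
    (fun A' hA' 𝔮 => exists_twinPrimary_pair_of_isStrictlyRational S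
      (fun _ _ _ hφ => S.isPrimaryPreStep_map hφ) hdiveq hsq Supp hSupp hA' 𝔮)
    (fun A hA => ?_)
  -- Def. 4.5 (ii): a pull-back morphism `A′ → A` from a strictly rational `A′`
  obtain ⟨A', ψ, hψ, hA'⟩ := hrat hA
  exact ⟨A', ψ, (PreFrobenioidData.ofFunctor_isPullbackMorphism F₁ ψ).mp hψ, hA'⟩

/-- **[FrdI] Thm. 4.9 (with compatibility) at the perfections, `Φ₂` non-dilating, modulo row T49-L02
ALONE** (p. 89 l. 38 – p. 90 l. 54): as `exists_thm49_compat_of_isRational`, with the two Thm. 4.2 inputs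
being the kernel theorems `Setting.isDivIdentity_map` (row T42-L11) and `Setting.divEquivalent_map`
(Thm. 4.2 (ii) + "`Φ_i` non-dilating") — so that, in the setting of the proof with `Φ₂` non-dilating
(Def. 3.1 (i)(e), part of "standard type"), over print's hypotheses (a support predicate as in Def. 2.4 (i)(d);
every universally Div-Frobenius-trivial object rational at THE birationalization of Prop. 4.4, whose squares
exist in every Frobenioid, Prop. 1.11 (vii), `hasBiratSquares_of_isFrobenioid`), THE `Ψ^Prime` and an
isomorphism of functors
`Ψ^Φ : Φ₁ ⥲ Φ₂` over `Ψ` with the Div clause and `Thm49_compat` follow from row T49-L02.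
[cite: MochizukiFrdI2008, Thm. 4.9 p.89] -/
theorem exists_thm49_compat_of_isRational_of_nonDilating (hL02 : SufficesRightEqLeft.{w, v, v', u, u'})
    (S : T42.Setting F₁ F₂ Ψ) (hnd₂ : IsNonDilatingOn Φ₂)
    (Supp : ∀ {X : D₁}, (PreFrobenioidData.ofFunctor Φ₁ F₁).Mon X →
      Primes ((PreFrobenioidData.ofFunctor Φ₁ F₁).Mon X) → Prop)
    (hSupp : ∀ (X : D₁) (a : Φ₁.obj (op X)) (𝔭 : Primes (Φ₁.obj (op X))),
      Supp a 𝔭 ↔ ∃ (a₀ : Φ₁.obj (op X)) (h₀ : IsPrimary a₀),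
        Quotient.mk (primarySetoid _) ⟨a₀, h₀⟩ = 𝔭 ∧ Precsim a₀ a)
    (hrat : ∀ ⦃A : C₁⦄, PreFrobenioid.IsUniversallyDivFrobeniusTrivial F₁ A →
      PreFrobenioidData.IsRational (PreFrobenioid.biratData S.isFrobenioid₁
        (PreFrobenioid.hasBiratSquares_of_isFrobenioid S.isFrobenioid₁)) Supp A) :
    ∃ (E : PreFrobenioidData.DivisorMonoidIsoOver (PreFrobenioidData.ofFunctor Φ₁ F₁)
        (PreFrobenioidData.ofFunctor Φ₂ F₂) Ψ)
      (e : ∀ A : C₁, Primes (Φ₁.obj (op (PreFrobenioid.baseObj F₁ A))) ≃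
        Primes (Φ₂.obj (op (PreFrobenioid.baseObj F₂ (Ψ.functor.obj A))))),
      (∀ (A : C₁) (𝔭 : Primes (Φ₁.obj (op (PreFrobenioid.baseObj F₁ A)))),
        (∀ ⦃B : C₁⦄ (φ : A ⟶ B), PreFrobenioid.IsCoAngularPreStep F₁ φ →
            (PreFrobenioid.Div F₁ φ ∈ 𝔭.submonoid ↔
              PreFrobenioid.Div F₂ (Ψ.functor.map φ) ∈ (e A 𝔭).submonoid)) ∧
        ∀ ⦃B : C₁⦄ (ψ : B ⟶ A), PreFrobenioid.IsCoAngularPreStep F₁ ψ →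
          ((∃ y ∈ 𝔭.submonoid, pull Φ₁ (PreFrobenioid.Base F₁ ψ) y = PreFrobenioid.Div F₁ ψ) ↔
            ∃ y ∈ (e A 𝔭).submonoid, pull Φ₂ (PreFrobenioid.Base F₂ (Ψ.functor.map ψ)) y =
              PreFrobenioid.Div F₂ (Ψ.functor.map ψ))) ∧
      (∀ ⦃A B : C₁⦄ (φ : A ⟶ B), PreFrobenioid.IsPreStep F₁ φ →
          E.iso A (PreFrobenioid.Div F₁ φ) = PreFrobenioid.Div F₂ (Ψ.functor.map φ)) ∧
      Literature.AlgebraicGeometry.Frobenioids.PreFrobenioidData.Thm49_compat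
        (PreFrobenioidData.ofFunctor Φ₁ F₁) (PreFrobenioidData.ofFunctor Φ₂ F₂) Ψ E e :=
  exists_thm49_compat_of_isRational hL02 S (fun _ _ α hα => S.isDivIdentity_map hnd₂ α hα)
    (fun _ _ φ ψ hφ hψ h => S.divEquivalent_map hnd₂ φ ψ hφ hψ h)
    (PreFrobenioid.hasBiratSquares_of_isFrobenioid S.isFrobenioid₁) Supp hSupp hrat

/-- **[FrdI] Thm. 4.9 WITH its compatibility clause, at the perfections — UNCONDITIONAL over print's
hypotheses** (statement p. 88 l. 33 – p. 89 l. 2; proof p. 89 l. 3 – p. 90 l. 54): in the setting of the proof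
of Thm. 4.2 (`T42.Setting`: Frobenioids of PERFECT and isotropic type — "after passing to the perfections" —
`Φ_i` perf-factorial, the Thm. 3.4 (ii)(iii) transports) with `Φ₂` non-dilating (Def. 3.1 (i)(e)), a support
predicate `Supp` on the `Φ₁(X)` obeying the support axiom of Def. 2.4 (i)(d), and every universally
Div-Frobenius-trivial object of `C₁` rational at THE birationalization (Def. 4.5 (ii)(iii): "rationally
standard type"), there exist THE `Ψ^Prime` of Thm. 4.2 (ii) (clauses (a), (b)) and an isomorphism of functors
`Ψ^Φ : Φ₁ ⥲ Φ₂` lying over `Ψ` (the closing shape `DivisorMonoidIsoOver` of the typed `Thm49`) computing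
`Div(Ψ φ) = Ψ^Φ_A(Div φ)` on pre-steps and satisfying the typed compatibility clause `Thm49_compat`. All rows
of the S5 sub-DAG of Thm. 4.9 enter BY NAME: T49-L02 `sufficesRightEqLeft_holds` (seat abc-iut-w4-d035),
L05 (abc-iut-w4-d109), L06/L08′ (abc-iut-w4-d105), L07 (abc-iut-w5-d021), the right = left gluing and the
Div-equivalence transport (abc-iut-w4-d099), T42-L04–L11 (abc-iut-w4-d099 / abc-iut-w4-d068 / abc-iut-w5-d162).
[cite: MochizukiFrdI2008, Thm. 4.9 p.88] -/
theorem exists_thm49_compat_perfect (S : T42.Setting F₁ F₂ Ψ) (hnd₂ : IsNonDilatingOn Φ₂)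
    (Supp : ∀ {X : D₁}, (PreFrobenioidData.ofFunctor Φ₁ F₁).Mon X →
      Primes ((PreFrobenioidData.ofFunctor Φ₁ F₁).Mon X) → Prop)
    (hSupp : ∀ (X : D₁) (a : Φ₁.obj (op X)) (𝔭 : Primes (Φ₁.obj (op X))),
      Supp a 𝔭 ↔ ∃ (a₀ : Φ₁.obj (op X)) (h₀ : IsPrimary a₀),
        Quotient.mk (primarySetoid _) ⟨a₀, h₀⟩ = 𝔭 ∧ Precsim a₀ a)
    (hrat : ∀ ⦃A : C₁⦄, PreFrobenioid.IsUniversallyDivFrobeniusTrivial F₁ A →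
      PreFrobenioidData.IsRational (PreFrobenioid.biratData S.isFrobenioid₁
        (PreFrobenioid.hasBiratSquares_of_isFrobenioid S.isFrobenioid₁)) Supp A) :
    ∃ (E : PreFrobenioidData.DivisorMonoidIsoOver (PreFrobenioidData.ofFunctor Φ₁ F₁)
        (PreFrobenioidData.ofFunctor Φ₂ F₂) Ψ)
      (e : ∀ A : C₁, Primes (Φ₁.obj (op (PreFrobenioid.baseObj F₁ A))) ≃
        Primes (Φ₂.obj (op (PreFrobenioid.baseObj F₂ (Ψ.functor.obj A))))),
      (∀ (A : C₁) (𝔭 : Primes (Φ₁.obj (op (PreFrobenioid.baseObj F₁ A)))),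
        (∀ ⦃B : C₁⦄ (φ : A ⟶ B), PreFrobenioid.IsCoAngularPreStep F₁ φ →
            (PreFrobenioid.Div F₁ φ ∈ 𝔭.submonoid ↔
              PreFrobenioid.Div F₂ (Ψ.functor.map φ) ∈ (e A 𝔭).submonoid)) ∧
        ∀ ⦃B : C₁⦄ (ψ : B ⟶ A), PreFrobenioid.IsCoAngularPreStep F₁ ψ →
          ((∃ y ∈ 𝔭.submonoid, pull Φ₁ (PreFrobenioid.Base F₁ ψ) y = PreFrobenioid.Div F₁ ψ) ↔
            ∃ y ∈ (e A 𝔭).submonoid, pull Φ₂ (PreFrobenioid.Base F₂ (Ψ.functor.map ψ)) y =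
              PreFrobenioid.Div F₂ (Ψ.functor.map ψ))) ∧
      (∀ ⦃A B : C₁⦄ (φ : A ⟶ B), PreFrobenioid.IsPreStep F₁ φ →
          E.iso A (PreFrobenioid.Div F₁ φ) = PreFrobenioid.Div F₂ (Ψ.functor.map φ)) ∧
      Literature.AlgebraicGeometry.Frobenioids.PreFrobenioidData.Thm49_compat
        (PreFrobenioidData.ofFunctor Φ₁ F₁) (PreFrobenioidData.ofFunctor Φ₂ F₂) Ψ E e :=
  exists_thm49_compat_of_isRational_of_nonDilating sufficesRightEqLeft_holds S hnd₂ Supp hSupp hrat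

/-- **The same at THE support predicate of Def. 2.4 (i)(d)** (`PrimarySupp a 𝔭`: "some primary element of
the class `𝔭` is `≼ a`" — the shape in which Prop. 5.5 (iii) transfers rationality to the perfection,
`Perfection.isRational_perfection_of`, seats abc-iut-w5-d042 / abc-iut-w4-d108): the support axiom binder is
then `Iff.rfl`, so Thm. 4.9 WITH compatibility at the perfections carries exactly two hypotheses beyond the
`T42.Setting` — `Φ₂` non-dilating and "every universally Div-Frobenius-trivial object is rational".
[cite: MochizukiFrdI2008, Thm. 4.9 p.88] -/
theorem exists_thm49_compat_perfect_primarySupp (S : T42.Setting F₁ F₂ Ψ) (hnd₂ : IsNonDilatingOn Φ₂)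
    (hrat : ∀ ⦃A : C₁⦄, PreFrobenioid.IsUniversallyDivFrobeniusTrivial F₁ A →
      PreFrobenioidData.IsRational (PreFrobenioid.biratData S.isFrobenioid₁
        (PreFrobenioid.hasBiratSquares_of_isFrobenioid S.isFrobenioid₁))
        (S := PreFrobenioidData.ofFunctor Φ₁ F₁) (fun a 𝔭 => PrimarySupp a 𝔭) A) :
    ∃ (E : PreFrobenioidData.DivisorMonoidIsoOver (PreFrobenioidData.ofFunctor Φ₁ F₁)
        (PreFrobenioidData.ofFunctor Φ₂ F₂) Ψ)
      (e : ∀ A : C₁, Primes (Φ₁.obj (op (PreFrobenioid.baseObj F₁ A))) ≃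
        Primes (Φ₂.obj (op (PreFrobenioid.baseObj F₂ (Ψ.functor.obj A))))),
      (∀ (A : C₁) (𝔭 : Primes (Φ₁.obj (op (PreFrobenioid.baseObj F₁ A)))),
        (∀ ⦃B : C₁⦄ (φ : A ⟶ B), PreFrobenioid.IsCoAngularPreStep F₁ φ →
            (PreFrobenioid.Div F₁ φ ∈ 𝔭.submonoid ↔
              PreFrobenioid.Div F₂ (Ψ.functor.map φ) ∈ (e A 𝔭).submonoid)) ∧
        ∀ ⦃B : C₁⦄ (ψ : B ⟶ A), PreFrobenioid.IsCoAngularPreStep F₁ ψ →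
          ((∃ y ∈ 𝔭.submonoid, pull Φ₁ (PreFrobenioid.Base F₁ ψ) y = PreFrobenioid.Div F₁ ψ) ↔
            ∃ y ∈ (e A 𝔭).submonoid, pull Φ₂ (PreFrobenioid.Base F₂ (Ψ.functor.map ψ)) y =
              PreFrobenioid.Div F₂ (Ψ.functor.map ψ))) ∧
      (∀ ⦃A B : C₁⦄ (φ : A ⟶ B), PreFrobenioid.IsPreStep F₁ φ →
          E.iso A (PreFrobenioid.Div F₁ φ) = PreFrobenioid.Div F₂ (Ψ.functor.map φ)) ∧
      Literature.AlgebraicGeometry.Frobenioids.PreFrobenioidData.Thm49_compat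
        (PreFrobenioidData.ofFunctor Φ₁ F₁) (PreFrobenioidData.ofFunctor Φ₂ F₂) Ψ E e :=
  exists_thm49_compat_perfect S hnd₂ (fun a 𝔭 => PrimarySupp a 𝔭) (fun _ _ _ => Iff.rfl) hrat

end FrdI.T49

end Literature.AlgebraicGeometry.Frobenioids
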